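import Literature.Computability.Complexity.Oracle
import Literature.Computability.Complexity.Transducers
import Literature.Computability.Complexity.TimeBoundsProofs
import Literature.Computability.Complexity.RandomizedProofs
import HarnessLib

/-!
# Oracle machines reading only the first symbol of each answer (`OracleAlg.trimAnswers`)

Toolkit for Bennett–Gill's coin-flip simulator (`LazySamplingMachine.lean`, discharging
`Literature.Computability.Complexity.almostP_subset_BPP`). In G01's transcript model
(`Oracle.lean`) the step function of an oracle algorithm sees the whole answer strings; against a
*language* oracle every answer is a single symbol, so `M` and the machine
`M.trimAnswers` — `M` applied to the answers truncated to their first symbol — have the same runs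
(`run_trimAnswers_ofLanguage`). The point of `trimAnswers` is that an oracle may then *echo*
arbitrary bookkeeping after the answer bit without `M` noticing (the simulator's oracle echoes the
query, so that the history of queries travels in the transcript).

* `TrimAnswers.trimT` — a finite-state transducer computing, on the code
  `⟨x, ⟨1ⁿ, ⟨a₀, … ⟨aₙ₋₁, ε⟩…⟩⟩⟩` of a step-function input `(x, [a₀, …, aₙ₋₁])`, the code of
  `(x, [a₀ ↾ 1, …, aₙ₋₁ ↾ 1])` (`trimT_eval`): the doubled-bit framing of `boolPair` is parsed
  locally — copy pairs through the two separators, then per list element emit the first doubled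
  pair and skip to the separator; `FST.polyTimeComputable_eval` makes it polynomial time;
* `OracleAlg.trimAnswers`, `isPolyTime_trimAnswers` (composition with the transducer,
  `PolyTimeComputable.comp_holds` / `of_encode_eq`), `runAux_trimAnswers` /
  `queriesAux_trimAnswers` / `run_trimAnswers_ofLanguage`.

## References

* S. Arora, B. Barak, *Computational Complexity: A Modern Approach*, CUP 2009, §3.4 (oracle
  machines), §1.3 (finite control).
* J. E. Hopcroft, J. D. Ullman, *Introduction to Automata Theory, Languages, and Computation*,
  1979, §2.7 (Mealy machines).
-/

namespace Literature.Computability.Complexity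

open _root_.Computability

namespace TrimAnswers

/-- Phases of the trimming transducer. [folklore] -/
inductive Ph
  | px   -- copying the doubled input `x`
  | hdr  -- copying the doubled unary length header
  | blk  -- at the start of a list element
  | skp  -- skipping the rest of a list element
  deriving DecidableEq, Fintype

/-- The transition on a completed pair of input symbols, per phase: a doubled bit is copied
(phases `px`, `hdr`), copied with a switch to skipping (`blk`), or swallowed (`skp`); the
separator `01` advances the phase; a malformed pair `10` is copied. [folklore] -/
def pairStep : Ph → Bool → Bool → Ph × List Bool
  | ph, b₁, b₂ =>
    if b₁ = b₂ then
      match ph with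
      | .px => (.px, [b₁, b₁])
      | .hdr => (.hdr, [b₁, b₁])
      | .blk => (.skp, [b₁, b₁])
      | .skp => (.skp, [])
    else if b₁ = false then
      match ph with
      | .px => (.hdr, [false, true])
      | .hdr => (.blk, [false, true])
      | .blk => (.blk, [false, true])
      | .skp => (.blk, [false, true])
    else (ph, [b₁, b₂])

/-- The transition: buffer the first symbol of a pair, act on the completed pair. [folklore] -/
def step : Ph × Option Bool → Bool → (Ph × Option Bool) × List Bool
  | (ph, none), b => ((ph, some b), [])
  | (ph, some b₁), b₂ => (((pairStep ph b₁ b₂).1, none), (pairStep ph b₁ b₂).2)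

/-- The trimming transducer (states: phase and the pending first symbol of the current pair). [folklore] -/
def trimT : FST (Ph × Option Bool) Bool Bool where
  init := (.px, none)
  step := step
  front _ := []
  keep _ := true

/-- The transition of `trimT` (definitional). [folklore] -/
@[simp] theorem trimT_step (s : Ph × Option Bool) (b : Bool) : trimT.step s b = step s b := rfl

/-- Doubling every symbol (the first-component code of `boolPair`). [folklore] -/
def dbl (l : List Bool) : List Bool := l.flatMap fun b => [b, b]

/-- Doubling the empty word. [folklore] -/
@[simp] theorem dbl_nil : dbl [] = [] := rfl

/-- Doubling a nonempty word. [folklore] -/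
@[simp] theorem dbl_cons (b : Bool) (l : List Bool) : dbl (b :: l) = b :: b :: dbl l := by simp [dbl]

/-- `boolPair x y = dbl x ++ 01 ++ y` (definitional). [folklore] -/
theorem boolPair_eq (x y : List Bool) : boolPair x y = dbl x ++ [false, true] ++ y := rfl

/-- Copy phases copy doubled words. [folklore] -/
theorem run_dbl_copy (ph : Ph) (hph : ph = .px ∨ ph = .hdr) (l rest : List Bool) :
    trimT.run (ph, none) (dbl l ++ rest) =
      ((trimT.run (ph, none) rest).1, dbl l ++ (trimT.run (ph, none) rest).2) := by
  induction l with
  | nil => simp [dbl]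
  | cons b l ih =>
    have : dbl (b :: l) ++ rest = b :: b :: (dbl l ++ rest) := by simp
    rw [this, FST.run_cons, FST.run_cons]
    rcases hph with rfl | rfl <;> simp [step, pairStep, ih]

/-- The separator ends phase `px`. [folklore] -/
theorem run_sep_px (rest : List Bool) :
    trimT.run (.px, none) (false :: true :: rest) =
      ((trimT.run (.hdr, none) rest).1, false :: true :: (trimT.run (.hdr, none) rest).2) := by
  simp [step, pairStep]

/-- The separator ends phase `hdr`. [folklore] -/
theorem run_sep_hdr (rest : List Bool) :
    trimT.run (.hdr, none) (false :: true :: rest) =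
      ((trimT.run (.blk, none) rest).1, false :: true :: (trimT.run (.blk, none) rest).2) := by
  simp [step, pairStep]

/-- The skip phase swallows doubled words. [folklore] -/
theorem run_dbl_skp (l rest : List Bool) :
    trimT.run (.skp, none) (dbl l ++ rest) = trimT.run (.skp, none) rest := by
  induction l with
  | nil => simp [dbl]
  | cons b l ih =>
    have : dbl (b :: l) ++ rest = b :: b :: (dbl l ++ rest) := by simp
    rw [this, FST.run_cons, FST.run_cons]
    simp [step, pairStep, ih]

/-- The body of a `listBool` code: the right-nested pairs of the items. [folklore] -/
def body (as : List (List Bool)) : List Bool := as.foldr (fun a acc => boolPair a acc) []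

/-- The body of a nonempty list. [folklore] -/
theorem body_cons (a : List Bool) (as : List (List Bool)) : body (a :: as) = boolPair a (body as) := rfl

/-- In block phase each list element contributes its first doubled symbol (if any) and its
separator: the body of the truncated list. [folklore] -/
theorem run_blk_body (as : List (List Bool)) (rest : List Bool) :
    trimT.run (.blk, none) (body as ++ rest) =
      ((trimT.run (.blk, none) rest).1, body (as.map (List.take 1)) ++ (trimT.run (.blk, none) rest).2) := by
  induction as with
  | nil => simp [body]
  | cons a as ih =>
    rw [List.map_cons, body_cons, body_cons, boolPair_eq, boolPair_eq]
    cases a with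
    | nil =>
      simp only [dbl, List.flatMap_nil, List.nil_append, List.take_nil, List.cons_append]
      rw [FST.run_cons, FST.run_cons]
      simp [step, pairStep, ih]
    | cons c a' =>
      have h1 : dbl (c :: a') ++ [false, true] ++ body as ++ rest =
          c :: c :: (dbl a' ++ (false :: true :: (body as ++ rest))) := by simp [dbl]
      rw [h1, FST.run_cons, FST.run_cons]
      simp only [trimT_step, step, pairStep, if_true, List.take_succ_cons, List.take_zero]
      rw [run_dbl_skp, FST.run_cons, FST.run_cons]
      simp [step, pairStep, ih, dbl]

/-- **Specification of the trimming transducer on codes**: the code of `(x, as)` is mapped to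
the code of `(x, as.map (· ↾ 1))`. [cite: AroraBarak2009, §1.3 (finite control)] -/
theorem trimT_eval (x : List Bool) (as : List (List Bool)) :
    trimT.eval (boolPair x ((encodingList Bool).listBool.encode as)) =
      boolPair x ((encodingList Bool).listBool.encode (as.map (List.take 1))) := by
  have henc : ∀ l : List (List Bool), (encodingList Bool).listBool.encode l =
      boolPair (unaryEncodeNat l.length) (body l) := fun l => rfl
  rw [henc, henc, List.length_map, FST.eval]
  simp only [trimT, ite_true, List.nil_append]
  change (FST.run trimT (.px, none) _).2 = _
  rw [boolPair_eq, boolPair_eq x, List.append_assoc, run_dbl_copy .px (Or.inl rfl)]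
  simp only [List.cons_append, List.nil_append]
  rw [run_sep_px, boolPair_eq, boolPair_eq (unaryEncodeNat _), List.append_assoc,
    run_dbl_copy .hdr (Or.inr rfl)]
  simp only [List.cons_append, List.nil_append]
  rw [run_sep_hdr, ← List.append_nil (body as), run_blk_body]
  simp

/-- `trimT.eval ∈ FP` (finite-state transductions are polynomial time). [folklore] -/
theorem trimT_eval_mem_FP : trimT.eval ∈ FP := trimT.polyTimeComputable_eval

end TrimAnswers

namespace OracleAlg

variable {β : Type}

/-- `M.trimAnswers`: the oracle algorithm `M` applied to the answers truncated to their first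
symbol. [folklore] -/
def trimAnswers (M : OracleAlg β) : OracleAlg β where
  step x as := M.step x (as.map (List.take 1))

/-- The step of `M.trimAnswers` (definitional). [folklore] -/
theorem trimAnswers_step (M : OracleAlg β) (x : List Bool) (as : List (List Bool)) :
    M.trimAnswers.step x as = M.step x (as.map (List.take 1)) := rfl

/-- **`M.trimAnswers` is polynomial-time** when `M` is (precompose the step machine with the
trimming transducer). [cite: AroraBarak2009, §1.3 (closure under composition)] -/
theorem isPolyTime_trimAnswers {M : OracleAlg β} {eb : Encoding β Bool} (hM : M.IsPolyTime eb) :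
    M.trimAnswers.IsPolyTime eb := by
  unfold IsPolyTime at hM ⊢
  have hpre : PolyTimeComputable
      (fun p : List Bool × List (List Bool) => boolPair p.1 ((encodingList Bool).listBool.encode p.2))
      (fun p : List Bool × List (List Bool) => boolPair p.1 ((encodingList Bool).listBool.encode p.2))
      (fun p : List Bool × List (List Bool) => (p.1, p.2.map (List.take 1))) :=
    PolyTimeComputable.of_encode_eq
      (fun p : List Bool × List (List Bool) => boolPair p.1 ((encodingList Bool).listBool.encode p.2))
      (fun _ => rfl) (fun p => TrimAnswers.trimT_eval p.1 p.2) TrimAnswers.trimT.polyTimeComputable_eval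
  have h := PolyTimeComputable.comp_holds hM hpre
  exact h

/-- Against an oracle with single-symbol answers, from a transcript of single symbols,
`M.trimAnswers` runs as `M`. [folklore] -/
theorem runAux_trimAnswers (M : OracleAlg β) (O : Oracle) (hO : ∀ q, (O q).length ≤ 1) (x : List Bool) :
    ∀ (n : ℕ) (as : List (List Bool)), (∀ a ∈ as, a.length ≤ 1) →
      M.trimAnswers.runAux O x n as = M.runAux O x n as
  | 0, _, _ => rfl
  | n + 1, as, has => by
    have hmap : as.map (List.take 1) = as := by
      conv_rhs => rw [← List.map_id as]
      exact List.map_congr_left fun a ha => List.take_of_length_le (has a ha)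
    rw [runAux_succ, runAux_succ, trimAnswers_step, hmap]
    cases M.step x as with
    | inr b => rfl
    | inl q =>
      exact runAux_trimAnswers M O hO x n _ fun a ha => by
        rcases List.mem_append.1 ha with h | h
        · exact has a h
        · simp at h; rw [h]; exact hO q

/-- … and asks the same queries. [folklore] -/
theorem queriesAux_trimAnswers (M : OracleAlg β) (O : Oracle) (hO : ∀ q, (O q).length ≤ 1) (x : List Bool) :
    ∀ (n : ℕ) (as : List (List Bool)), (∀ a ∈ as, a.length ≤ 1) →
      M.trimAnswers.queriesAux O x n as = M.queriesAux O x n as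
  | 0, _, _ => rfl
  | n + 1, as, has => by
    have hmap : as.map (List.take 1) = as := by
      conv_rhs => rw [← List.map_id as]
      exact List.map_congr_left fun a ha => List.take_of_length_le (has a ha)
    unfold queriesAux
    rw [trimAnswers_step, hmap]
    cases M.step x as with
    | inr b => rfl
    | inl q =>
      simp only [List.cons.injEq, true_and]
      exact queriesAux_trimAnswers M O hO x n _ fun a ha => by
        rcases List.mem_append.1 ha with h | h
        · exact has a h
        · simp at h; rw [h]; exact hO q

/-- In particular `M.trimAnswers` and `M` have the same runs and queries against every language
oracle (so they decide the same languages, `PRel`). [folklore] -/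
theorem run_trimAnswers_ofLanguage (M : OracleAlg β) (A : Language Bool) (n : ℕ) (x : List Bool) :
    M.trimAnswers.run (Oracle.ofLanguage A) n x = M.run (Oracle.ofLanguage A) n x ∧
      M.trimAnswers.queries (Oracle.ofLanguage A) n x = M.queries (Oracle.ofLanguage A) n x :=
  ⟨runAux_trimAnswers M _ (fun q => by simp [Oracle.ofLanguage, encodeBool]) x n [] (by simp),
   queriesAux_trimAnswers M _ (fun q => by simp [Oracle.ofLanguage, encodeBool]) x n [] (by simp)⟩

end OracleAlg

end Literature.Computability.Complexity
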